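import Summits.KontsevichZagierPeriods.KontsevichZagierPeriods.Theses.MarkovTreeOfMoves

/-!
# `Assembly` (stmt-KontsevichZagierPeriods-4547, route MarkovTreeOfMoves) — proof

The route's assembly item `PeriodSequenceMove → LaurentMoveKernel → KontsevichZagierPeriods` is
its deciding theorem `closes` read as an implication. (lead c10 of crux 9129, banking)
-/

namespace Summit.KontsevichZagierPeriods.MarkovTreeOfMoves

/-- **Assembly of route MarkovTreeOfMoves** (stmt-KontsevichZagierPeriods-4547):
`PeriodSequenceMove → LaurentMoveKernel → KontsevichZagierPeriods` — the cruxes imply the summit,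
by the route's deciding theorem `closes` (the kernel item at `R := KZ.relations`, its closure
hypothesis discharged by `PeriodSequenceMove`; equal values give `KZ.eval ([r] - [r']) = 0`).
[Kontsevich–Zagier 2001, §1.2] [folklore] -/
theorem assembly_proof :
    Summit.KontsevichZagierPeriods.KontsevichZagierPeriods.Theses.MarkovTreeOfMoves.Assembly :=
  Summit.KontsevichZagierPeriods.KontsevichZagierPeriods.Theses.MarkovTreeOfMoves.closes

end Summit.KontsevichZagierPeriods.MarkovTreeOfMoves
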